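import Mathlib
import HarnessLib


/-!
# K1 + K1′ (card `reshaping-generic`, val-idea-23 g2) — part 1/4: geometric off-diagonal sums, diagonal dominance, gap-Monge decay

Sections A–B of the original file (verbatim): `Nat.dist`, `sum_pow_ndist_le`, `det_ne_zero_of_abs_decay` (Levy–Desplanques for
exponentially decaying entries), `telescope_rows`, `decay_of_gapMonge`.

AUTHORSHIP: val-idea-23 g2 (card `reshaping-generic`, crux workfile `Cruxes/MatrixDescartes/ReshapingGenericK1Proof.lean` rev 4,
staged bytes sha12 527413dd06f8); SPLIT into four ≤ 400-line files and landed by val-lit-p7 g14 (landing hand, director R290 (2)(iii) /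
desk RULING #329) with no mathematical change: parts `…ReshapingGenericDecay` (A–B), `…ReshapingGenericLogConcave` (C–D),
`…ReshapingGenericHankel` (D′), `…ReshapingGeneric` (K1 positive form, F Kronecker, E K1Check).  VP ≠ VNP is not touched.
-/

set_option linter.dupNamespace false
set_option autoImplicit false

namespace Summit.ValiantsHypothesis.ValiantsHypothesis.Theorems.LacunarySymmetroidMatrixDescartes.ReshapingGeneric

open Finset Real Matrix

/-! ## A. Geometric off-diagonal sums and diagonal dominance -/

/-- `Nat.dist k n = k - n` for `n < k`. [folklore] -/
lemma ndist_of_lt {k n : ℕ} (h : n < k) : Nat.dist k n = k - n := by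
  simp [Nat.dist, Nat.sub_eq_zero_of_le h.le]

/-- `Nat.dist k n = n - k` for `k < n`. [folklore] -/
lemma ndist_of_gt {k n : ℕ} (h : k < n) : Nat.dist k n = n - k := by
  simp [Nat.dist, Nat.sub_eq_zero_of_le h.le]

/-- The off-diagonal geometric sum along one row of an `r × r` index set is at most `2θ/(1-θ)`. -/
lemma sum_pow_ndist_le (θ : ℝ) (hθ0 : 0 ≤ θ) (hθ1 : θ < 1) (r k : ℕ) (hk : k < r) :
    ∑ n ∈ (range r).erase k, θ ^ Nat.dist k n ≤ 2 * (θ / (1 - θ)) := by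
  have hsplit : (range r).erase k = (range k) ∪ (Ico (k + 1) r) := by
    ext n; simp [Finset.mem_Ico]; omega
  have hdisj : Disjoint (range k) (Ico (k + 1) r) := by
    rw [Finset.disjoint_left]; intro n hn; simp [Finset.mem_Ico] at hn ⊢; omega
  rw [hsplit, Finset.sum_union hdisj]
  -- left part: n < k, exponent k - n ∈ [1, k]
  have hL : ∑ n ∈ range k, θ ^ Nat.dist k n ≤ θ / (1 - θ) := by
    have h1 : ∑ n ∈ range k, θ ^ Nat.dist k n = ∑ n ∈ range k, θ ^ (k - n) := by
      apply Finset.sum_congr rfl; intro n hn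
      rw [ndist_of_lt (Finset.mem_range.mp hn)]
    rw [h1]
    have h2 : ∑ n ∈ range k, θ ^ (k - n) = ∑ j ∈ range k, θ ^ (j + 1) := by
      rw [← Finset.sum_range_reflect (fun n => θ ^ (k - n)) k]
      apply Finset.sum_congr rfl; intro j hj
      have := Finset.mem_range.mp hj
      congr 1; omega
    rw [h2]
    have h3 : ∑ j ∈ range k, θ ^ (j + 1) = ∑ j ∈ Ico 1 (k + 1), θ ^ j := by
      rw [Finset.sum_Ico_eq_sum_range]; apply Finset.sum_congr (by simp) ; intro j _; ring_nf
    rw [h3]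
    calc ∑ j ∈ Ico 1 (k + 1), θ ^ j ≤ θ ^ 1 / (1 - θ) := geom_sum_Ico_le_of_lt_one hθ0 hθ1
      _ = θ / (1 - θ) := by rw [pow_one]
  -- right part: n > k, exponent n - k ∈ [1, r-k-1]
  have hR : ∑ n ∈ Ico (k + 1) r, θ ^ Nat.dist k n ≤ θ / (1 - θ) := by
    have h1 : ∑ n ∈ Ico (k + 1) r, θ ^ Nat.dist k n = ∑ n ∈ Ico (k + 1) r, θ ^ (n - k) := by
      apply Finset.sum_congr rfl; intro n hn
      rw [ndist_of_gt (by simp [Finset.mem_Ico] at hn; omega)]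
    rw [h1]
    have h2 : ∑ n ∈ Ico (k + 1) r, θ ^ (n - k) = ∑ j ∈ Ico 1 (r - k), θ ^ j := by
      rw [Finset.sum_Ico_eq_sum_range, Finset.sum_Ico_eq_sum_range]
      have : r - k - 1 = r - (k + 1) := by omega
      rw [this]
      apply Finset.sum_congr rfl; intro t _; congr 1; omega
    rw [h2]
    calc ∑ j ∈ Ico 1 (r - k), θ ^ j ≤ θ ^ 1 / (1 - θ) := geom_sum_Ico_le_of_lt_one hθ0 hθ1
      _ = θ / (1 - θ) := by rw [pow_one]
  linarith

/-- **Diagonal dominance after decay (sign-blind).**  If `|N x x| = 1` and `|N x i| ≤ exp (-(log 4)·|x - i|)` off the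
diagonal, `N` is strictly diagonally dominant by rows, hence non-singular (Gershgorin / Levy–Desplanques); the signs of the
entries play no role. -/
theorem det_ne_zero_of_abs_decay {r : ℕ} (N : Matrix (Fin r) (Fin r) ℝ)
    (hdiag : ∀ x, |N x x| = 1)
    (hoff : ∀ x i, x ≠ i → |N x i| ≤ Real.exp (-(Real.log 4) * (Nat.dist x i : ℝ))) :
    N.det ≠ 0 := by
  apply det_ne_zero_of_sum_row_lt_diag
  intro k
  simp only [Real.norm_eq_abs]
  rw [hdiag]
  -- bound each off-diagonal term by (1/4)^Nat.dist
  have hterm : ∀ j ∈ Finset.univ.erase k, |N k j| ≤ (1 / 4 : ℝ) ^ Nat.dist (k : ℕ) (j : ℕ) := by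
    intro j hj
    have hne : k ≠ j := fun h => by simp [h] at hj
    have h1 : |N k j| ≤ Real.exp (-(Real.log 4) * (Nat.dist k j : ℝ)) := hoff k j hne
    have h2 : Real.exp (-(Real.log 4) * (Nat.dist (k : ℕ) (j : ℕ) : ℝ)) = (1 / 4 : ℝ) ^ Nat.dist (k : ℕ) (j : ℕ) := by
      rw [show -(Real.log 4) * (Nat.dist (k:ℕ) (j:ℕ) : ℝ) = (Nat.dist (k:ℕ) (j:ℕ) : ℝ) * Real.log (1/4) by
        rw [one_div, Real.log_inv]; ring]
      rw [Real.exp_nat_mul, Real.exp_log (by norm_num)]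
    exact h1.trans (le_of_eq h2)
  have hsum : ∑ j ∈ Finset.univ.erase k, |N k j|
      ≤ ∑ j ∈ Finset.univ.erase k, (1 / 4 : ℝ) ^ Nat.dist (k : ℕ) (j : ℕ) := Finset.sum_le_sum hterm
  -- transport the sum to `range r`
  have htrans : ∑ j ∈ Finset.univ.erase k, (1 / 4 : ℝ) ^ Nat.dist (k : ℕ) (j : ℕ)
      = ∑ n ∈ (range r).erase (k : ℕ), (1 / 4 : ℝ) ^ Nat.dist (k : ℕ) n := by
    set g : ℕ → ℝ := fun n => if n = (k : ℕ) then 0 else (1 / 4 : ℝ) ^ Nat.dist (k : ℕ) n with hg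
    have hgj : ∀ j : Fin r, j ≠ k → g (j : ℕ) = (1 / 4 : ℝ) ^ Nat.dist (k : ℕ) (j : ℕ) := by
      intro j hj
      have : (j : ℕ) ≠ (k : ℕ) := fun h => hj (Fin.ext h)
      simp [hg, this]
    have hgk : g (k : ℕ) = 0 := by simp [hg]
    calc ∑ j ∈ Finset.univ.erase k, (1 / 4 : ℝ) ^ Nat.dist (k : ℕ) (j : ℕ)
        = ∑ j ∈ Finset.univ.erase k, g (j : ℕ) :=
          Finset.sum_congr rfl (fun j hj => (hgj j (Finset.ne_of_mem_erase hj)).symm)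
      _ = ∑ j : Fin r, g (j : ℕ) - g (k : ℕ) := by rw [Finset.sum_erase_eq_sub (Finset.mem_univ k)]
      _ = ∑ n ∈ range r, g n - g (k : ℕ) := by rw [Fin.sum_univ_eq_sum_range]
      _ = ∑ n ∈ (range r).erase (k : ℕ), g n := by
          rw [Finset.sum_erase_eq_sub (Finset.mem_range.mpr k.isLt)]
      _ = ∑ n ∈ (range r).erase (k : ℕ), (1 / 4 : ℝ) ^ Nat.dist (k : ℕ) n :=
          Finset.sum_congr rfl (fun n hn => by
            have : n ≠ (k : ℕ) := Finset.ne_of_mem_erase hn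
            simp [hg, this])
  have hgeo := sum_pow_ndist_le (1 / 4 : ℝ) (by norm_num) (by norm_num) r k k.isLt
  have : (2 : ℝ) * ((1 / 4) / (1 - 1 / 4)) = 2 / 3 := by norm_num
  linarith [hsum, htrans ▸ hgeo]


/-! ## B. Potentials: increments with a gap in the column index ⇒ two-sided exponential decay -/

/-- Telescoping along the row index. -/
lemma telescope_rows (W : ℕ → ℕ → ℝ) (i x c : ℕ) (hix : i ≤ x) :
    W x c - W i c = ∑ j ∈ Ico i x, (W (j + 1) c - W j c) := by
  rw [Finset.sum_Ico_eq_sum_range]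
  have h := Finset.sum_range_sub (fun t => W (i + t) c) (x - i)
  simp only [Nat.add_zero] at h
  rw [show i + (x - i) = x by omega] at h
  rw [← h]
  apply Finset.sum_congr rfl; intro t _; rw [← add_assoc]

/-- **Gap-Monge potentials.**  If the row increments `W (j+1) i - W j i` grow by at least `2L` per column step
(for indices below `r`), then with `u x = Σ_{j<x} m j` (`m j` the midpoint of the increments of columns `j`, `j+1` at
row step `j`) and `v i = W i i - u i` one has `W x i - u x - v i ≤ -L·|x - i|`, with equality `0` on the diagonal. -/
theorem decay_of_gapMonge (r : ℕ) (W : ℕ → ℕ → ℝ) (L : ℝ) (hL : 0 ≤ L)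
    (hW : ∀ j i, j + 1 < r → i + 1 < r → W (j + 1) i - W j i + 2 * L ≤ W (j + 1) (i + 1) - W j (i + 1)) :
    ∃ u v : ℕ → ℝ, (∀ x, x < r → W x x - u x - v x = 0) ∧
      ∀ x i, x < r → i < r → W x i - u x - v i ≤ -L * (Nat.dist x i : ℝ) := by
  set incr : ℕ → ℕ → ℝ := fun j i => W (j + 1) i - W j i with hincr
  -- monotonicity of the increments in the column index, with gap
  have hmono : ∀ j, j + 1 < r → ∀ i i', i ≤ i' → i' < r → incr j i + 2 * L * (i' - i : ℕ) ≤ incr j i' := by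
    intro j hj i i' hii' hi'
    induction i', hii' using Nat.le_induction with
    | base => simp
    | succ n hin ih =>
      have ih' := ih (by omega)
      have hstep := hW j n hj (by omega)
      have : ((n + 1 - i : ℕ) : ℝ) = (n - i : ℕ) + 1 := by
        rw [show n + 1 - i = (n - i) + 1 by omega]; push_cast; ring
      rw [this]
      simp only [hincr] at ih' hstep ⊢
      nlinarith
  set m : ℕ → ℝ := fun j => (incr j j + incr j (j + 1)) / 2 with hm
  have hm_lo : ∀ j, j + 1 < r → incr j j + L ≤ m j := by
    intro j hj
    have := hW j j hj hj
    simp only [hm, hincr] at this ⊢; linarith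
  have hm_hi : ∀ j, j + 1 < r → m j + L ≤ incr j (j + 1) := by
    intro j hj
    have := hW j j hj hj
    simp only [hm, hincr] at this ⊢; linarith
  set u : ℕ → ℝ := fun x => ∑ j ∈ range x, m j with hu
  set v : ℕ → ℝ := fun i => W i i - u i with hv
  refine ⟨u, v, fun x _ => by simp [hv], ?_⟩
  intro x i hx hi
  have hE : W x i - u x - v i = (W x i - W i i) - (u x - u i) := by simp [hv]; ring
  rw [hE]
  rcases lt_trichotomy i x with hlt | heq | hgt
  · -- below the diagonal: i < x
    have h1 : W x i - W i i = ∑ j ∈ Ico i x, incr j i := telescope_rows W i x i hlt.le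
    have h2 : u x - u i = ∑ j ∈ Ico i x, m j := by
      simp only [hu]; rw [Finset.sum_Ico_eq_sub _ hlt.le]
    rw [h1, h2, ← Finset.sum_sub_distrib]
    have hb : ∀ j ∈ Ico i x, incr j i - m j ≤ -L := by
      intro j hj
      rw [Finset.mem_Ico] at hj
      have hjr : j + 1 < r := by omega
      have := hmono j hjr i j hj.1 (by omega)
      have := hm_lo j hjr
      have : (0 : ℝ) ≤ 2 * L * ((j - i : ℕ) : ℝ) := by positivity
      linarith
    calc ∑ j ∈ Ico i x, (incr j i - m j) ≤ ∑ j ∈ Ico i x, (-L) := Finset.sum_le_sum hb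
      _ = -L * (Nat.dist x i : ℝ) := by
        rw [Finset.sum_const, Nat.card_Ico, ndist_of_lt hlt, nsmul_eq_mul]; ring
  · subst heq; simp
  · -- above the diagonal: x < i
    have h1 : W x i - W i i = -∑ j ∈ Ico x i, incr j i := by
      have h0 := telescope_rows W x i i hgt.le
      simp only [hincr]
      linarith
    have h2 : u x - u i = -∑ j ∈ Ico x i, m j := by
      simp only [hu]; rw [Finset.sum_Ico_eq_sub _ hgt.le]; ring
    have h3 : W x i - W i i - (u x - u i) = ∑ j ∈ Ico x i, (m j - incr j i) := by
      have hs := Finset.sum_sub_distrib (s := Ico x i) (f := m) (g := fun j => incr j i)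
      rw [h1, h2, hs]; ring
    rw [h3]
    have hb : ∀ j ∈ Ico x i, m j - incr j i ≤ -L := by
      intro j hj
      rw [Finset.mem_Ico] at hj
      have hjr : j + 1 < r := by omega
      have := hmono j hjr (j + 1) i (by omega) hi
      have := hm_hi j hjr
      have : (0 : ℝ) ≤ 2 * L * ((i - (j + 1) : ℕ) : ℝ) := by positivity
      linarith
    calc ∑ j ∈ Ico x i, (m j - incr j i) ≤ ∑ j ∈ Ico x i, (-L) := Finset.sum_le_sum hb
      _ = -L * (Nat.dist x i : ℝ) := by
        rw [Finset.sum_const, Nat.card_Ico, ndist_of_gt hgt, nsmul_eq_mul]; ring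


end Summit.ValiantsHypothesis.ValiantsHypothesis.Theorems.LacunarySymmetroidMatrixDescartes.ReshapingGeneric
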